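import Summits.HodgeConjecture.HodgeConjecture.Theorems.BoundaryReadoutBoundaryAbsoluteness
import HarnessLib

/-!
# Crux `BoundaryAbsoluteness` (stmt-HodgeConjecture-15913, route `BoundaryReadout`) — the strategist's
# typed split (glue for `route edit --split BoundaryAbsoluteness --into ConjugateClassesExist ConjugationNatural`)

`BoundaryAbsoluteness` (boundary Principle B; decl
`Summit.HodgeConjecture.HodgeConjecture.Theses.BoundaryReadout.BoundaryAbsoluteness`): for `f : 𝒳 ⟶ C`
surjective from a smooth projective variety onto a smooth projective curve, finitely many smooth
projective pieces `g_i : Y_i ⟶ X_o` jointly covering the fibre over `o`, and a rational `(p,p)` class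
`ξ ∈ H²ᵖ(𝒳(ℂ); ℂ)` whose restrictions `ξ|Y_i` are absolute Hodge: `ξ|X_t` is absolute Hodge on every
smooth projective fibre `X_t`.

This file is the GLUE of the crux-strategist's decomposition D1 (seat
planner-cstrat-stmt-HodgeConjecture-15913-0, gen 1, 2026-08-17; census
`Cruxes/BoundaryAbsoluteness/STRATEGY-CENSUS.md`): the crux follows, by theorems ALREADY LANDED in the
tree, from exactly two σ-INFRASTRUCTURE statements — the two stubs still open in the active skeleton
`Cruxes/BoundaryAbsoluteness/Lines/typewise_readout.lean` (v3), verbatim: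

* `C₁ = ConjugateClassesExist` — CONJUGATES EXIST: for `X` smooth projective over `ℂ`, `σ ∈ Aut ℂ`,
  `k` and `c ∈ Hᵏ(X(ℂ); ℂ)` there is a `σ`-conjugate class `c'` on `X^σ` (`IsConjugateClass`). Theorem
  in print (Jouanolou's affine torsor, GAGA, de Rham, Grothendieck's comparison on the affine chart,
  Charles–Schnell (11.2.2)–(11.2.3)); in the tree it is `exists_isConjugateClass_of_facts` modulo the
  named facts (J) `jouanolou_cohomologyChart`, (G) `grothendieck_comparison_realize_surjective`,
  (C) `conj_realize_mem_cclosedSmoothForms` of `Literature/…/ConjugationChartExistence` ((R) is the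
  theorem `RationallyNormalisedDeRhamFamily`), cf. `stub_conjugate_exists_of_JGC`
  (`BoundaryReadoutHCOverNumberFieldsConjugateExists`). VERBATIM the child `ConjugateClassesExist` of the
  strategist split proposed for the sibling crux `HCOverNumberFields`
  (`Cruxes/HCOverNumberFields/SPLIT-PROPOSAL.md`), so the two cruxes SHARE this item.
* `C₂ = ConjugationNatural` — CONJUGATION IS NATURAL AND SINGLE-VALUED along morphisms of smooth
  projective varieties: a conjugate (in ANY chart) of `g^* c` is `(g^σ)^*` of any conjugate of `c`.
  Theorem in print (Charles–Schnell §11.2.2: every chart computes the canonical `σ`-linear natural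
  `α ↦ α^σ`; Grothendieck 1966 Thm. 1'; the chart's de Rham family enters only through a rational
  constant, Conner–Floyd (15.3)); in the tree it is `conjugateNaturality_of_chartConjugation_canonical`
  modulo the named fact (N) `chartConjugation_canonical` of `Literature/…/ConjugationChartUniqueness`.

THEOREMS. `boundaryReadout_kernelDescent_of_subs` — `C₁ → C₂ →` "absoluteness descends along
conjugation-stable kernel inclusions" (the line's arithmetic half `KernelDescent`), from the LANDED
σ-free stubs `stub_rationalDescent` (p166041) and `stub_typeDescent` (p165961);
`boundaryAbsoluteness_of_subs : C₁ → C₂ → BoundaryAbsoluteness` — shape `C₁ → C₂ → C` for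
`ledger route edit route-HodgeConjecture-BoundaryReadout --split BoundaryAbsoluteness … --glue-by
Summit.HodgeConjecture.HodgeConjecture.Theorems.boundaryAbsoluteness_of_subs`, the kernel hypothesis on
every conjugate family being the LANDED unconditional `boundaryReadout_fibreKernelInclusion`
(`stub_conjugateFibre` p167082, `stub_smoothFibreLocus` p166992, `stub_vanishingPropagation` p166658).
The proofs are those of `kernelDescent_of` / `BoundaryAbsoluteness_of` of the skeleton with the landed
stubs substituted; nothing here is conditional on a named fact, and nothing closes the item (the two
hypotheses are open statements: any proof of the crux must build conjugation charts on the fibres,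
`Theorems/BoundaryAbsoluteness/Negative/HCSafety.nonempty_conjugationChart_fibre_of_boundaryAbsoluteness`,
and the crux without conjugate existence on the pieces / without the covering is Charles–Schnell
Conj. 11.2.17, `Theorems/BoundaryAbsoluteness/Negative/LoadBearing`). HONESTY: neither child is the
crux or the summit reworded — `C₁` speaks of one variety and no fibration, `C₂` of one morphism; `C₂`
alone gives no chart on `X_t` (so not the existence conjunct), `C₁` alone gives no control of an
arbitrary chart's conjugate (so not the `∀`-conjunct); both are theorems in print while the crux's
complement in the route (`BoundarySupply`, `HCOverNumberFields`) carries the open mathematics.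
Standard axioms only.

## References

* [CharlesSchnell2014Notes] F. Charles, C. Schnell, Notes on absolute Hodge classes, in *Hodge Theory*
  (Princeton Math. Notes 49, 2014), §11.2.2 (11.2.2)–(11.2.3), Def. 11.2.3, Thm. 11.3.7–11.3.8.
* [Deligne1982HodgeCycles] P. Deligne, Hodge cycles on abelian varieties, LNM 900 (1982), §2 Thm. 2.12, Lemma 2.13.
* [Jouanolou1973] J.-P. Jouanolou, Une suite exacte de Mayer–Vietoris en K-théorie algébrique, LNM 341 (1973), Lemme 1.5.
* [Grothendieck1966] A. Grothendieck, On the de Rham cohomology of algebraic varieties, Publ. IHÉS 29 (1966), Thm. 1'.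
-/

-- `Summit.HodgeConjecture.HodgeConjecture.Theorems` is the mandated namespace (single-problem summit).
set_option linter.dupNamespace false

noncomputable section

open CategoryTheory AlgebraicGeometry
open Literature.AlgebraicGeometry.Motives Literature.AlgebraicGeometry.HodgeTheory
open Summit.HodgeConjecture.HodgeConjecture.Theses.BoundaryReadout (BoundaryAbsoluteness)

namespace Summit.HodgeConjecture.HodgeConjecture.Theorems

/-- **Absoluteness descends along conjugation-stable kernel inclusions, from the two σ-infrastructure
statements** (`C₁` conjugates exist, `C₂` conjugation is natural). For `X` smooth projective, smooth
projective `h_i : Y_i ⟶ X` and `w : W ⟶ X` with `⋂ ker (h_i^σ)^* ⊆ ker (w^σ)^*` on every conjugate, and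
a rational `(p,p)` class `ξ` absolute Hodge on every `Y_i`: `w^* ξ` is absolute Hodge. For a conjugate
`c'` of `w^* ξ`: name a conjugate `Ξ'` of `ξ` (`C₁`), put `Θ := (2πi/σ(2πi))^{-p} Ξ'`; by `C₂`,
`c' = (w^σ)^* Ξ'` and the conjugates of the `h_i^* ξ` supplied by the hypothesis are the `(h_i^σ)^* Ξ'`,
so `Θ` restricts on the conjugate pieces to rational `(p,p)` classes; rationality
(`stub_rationalDescent`, landed) and type (`stub_typeDescent`, landed) descend along the kernel
inclusion on `X^σ`. [cite: CharlesSchnell2014Notes, Def. 11.2.3 and §11.2.2]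
[cite: Deligne1982HodgeCycles, §2 Lemma 2.13] -/
theorem boundaryReadout_kernelDescent_of_subs
    (h₁ : ∀ ⦃n : ℕ⦄ ⦃X : SchemeOver ℂ⦄, IsSmoothProjective n X →
      ∀ (σ : ℂ ≃+* ℂ) (k : ℕ) (c : complexBetti X k), ∃ c', IsConjugateClass σ X k c c')
    (h₂ : ∀ ⦃m n : ℕ⦄ ⦃Y X : SchemeOver ℂ⦄, IsSmoothProjective m Y → IsSmoothProjective n X →
      ∀ (g : Y ⟶ X) (σ : ℂ ≃+* ℂ) (k : ℕ) (c : complexBetti X k)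
        (c' : complexBetti (conjugateVariety σ X) k) (d' : complexBetti (conjugateVariety σ Y) k),
        IsConjugateClass σ X k c c' → IsConjugateClass σ Y k (complexBetti.map g k c) d' →
          d' = complexBetti.map (conjHom σ g) k c')
    {n : ℕ} {X : SchemeOver ℂ} (hX : IsSmoothProjective n X) {ι : Type} [Finite ι] {m : ι → ℕ}
    {Y : ι → SchemeOver ℂ} (h : ∀ i, Y i ⟶ X) (hY : ∀ i, IsSmoothProjective (m i) (Y i))
    {nW : ℕ} {W : SchemeOver ℂ} (w : W ⟶ X) (hW : IsSmoothProjective nW W)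
    (hker : ∀ (σ : ℂ ≃+* ℂ) (k : ℕ) (x : complexBetti (conjugateVariety σ X) k),
      (∀ i, complexBetti.map (conjHom σ (h i)) k x = 0) → complexBetti.map (conjHom σ w) k x = 0)
    (p : ℕ) (ξ : complexBetti X (2 * p)) (hξr : IsRationalClass ξ)
    (hξh : IsOfHodgeType n X (2 * p) p p ξ)
    (habs : ∀ i, IsAbsoluteHodgeClass (m i) (Y i) p (complexBetti.map (h i) (2 * p) ξ)) :
    IsAbsoluteHodgeClass nW W p (complexBetti.map w (2 * p) ξ) := by
  -- the `(p,p)` type of `w^* ξ` (pull-backs preserve Hodge types)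
  have hpp : IsOfHodgeType nW W (2 * p) p p (complexBetti.map w (2 * p) ξ) :=
    hξh.map_of_isSmoothProjective hW hX w
  refine ⟨hξr.pullback _, hpp, fun σ => ⟨h₁ hW σ (2 * p) _, fun c' hc' => ?_⟩⟩
  -- a conjugate `Ξ'` of the class `ξ` on `X^σ`
  obtain ⟨Ξ', hΞ'⟩ := h₁ hX σ (2 * p) ξ
  -- naturality: the given conjugate of `w^* ξ` is the pull-back of `Ξ'`
  have hc'eq : c' = complexBetti.map (conjHom σ w) (2 * p) Ξ' :=
    h₂ hW hX w σ (2 * p) ξ Ξ' c' hΞ' hc'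
  -- the untwisted conjugate
  obtain ⟨Θ, hΘ⟩ : ∃ Θ : complexBetti (conjugateVariety σ X) (2 * p), Θ = (periodTwist σ p)⁻¹ • Ξ' :=
    ⟨_, rfl⟩
  have htw : periodTwist σ p ≠ 0 := periodTwist_ne_zero σ p
  -- `Θ` restricts on every conjugate piece `Y_i^σ` to the RATIONAL `(p,p)`-class `β_i`
  have hΘY : ∀ i, IsRationalClass (complexBetti.map (conjHom σ (h i)) (2 * p) Θ) ∧
      IsOfHodgeType (m i) (conjugateVariety σ (Y i)) (2 * p) p p
        (complexBetti.map (conjHom σ (h i)) (2 * p) Θ) := by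
    intro i
    obtain ⟨d, hd⟩ := ((habs i).2.2 σ).1
    obtain ⟨βi, hβi, hβiH, hdβ⟩ := ((habs i).2.2 σ).2 d hd
    have hdΞ : d = complexBetti.map (conjHom σ (h i)) (2 * p) Ξ' :=
      h₂ (hY i) hX (h i) σ (2 * p) ξ Ξ' d hΞ' hd
    have hΘi : complexBetti.map (conjHom σ (h i)) (2 * p) Θ = βi := by
      rw [hΘ, map_smul, ← hdΞ, hdβ, smul_smul, inv_mul_cancel₀ htw, one_smul]
    rw [hΘi]
    exact ⟨hβi, hβiH⟩
  -- the conjugate varieties are smooth projective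
  have hX' : IsSmoothProjective n (conjugateVariety σ X) := IsSmoothProjective.conjugateVariety_holds σ hX
  have hY' : ∀ i, IsSmoothProjective (m i) (conjugateVariety σ (Y i)) := fun i =>
    IsSmoothProjective.conjugateVariety_holds σ (hY i)
  have hW' : IsSmoothProjective nW (conjugateVariety σ W) := IsSmoothProjective.conjugateVariety_holds σ hW
  -- descent along the kernel inclusion on `X^σ`, twice: rationality and type (LANDED stubs)
  have hβ : IsRationalClass (complexBetti.map (conjHom σ w) (2 * p) Θ) :=
    stub_rationalDescent hX' (fun i => conjHom σ (h i)) hY' (conjHom σ w) hW' (2 * p) (hker σ (2 * p)) Θ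
      (fun i => (hΘY i).1)
  have hβH : IsOfHodgeType nW (conjugateVariety σ W) (2 * p) p p
      (complexBetti.map (conjHom σ w) (2 * p) Θ) :=
    stub_typeDescent hX' (fun i => conjHom σ (h i)) hY' (conjHom σ w) hW' (2 * p) p p (hker σ (2 * p)) Θ
      (fun i => (hΘY i).2)
  have hc'β : c' = periodTwist σ p • complexBetti.map (conjHom σ w) (2 * p) Θ := by
    rw [hc'eq, hΘ, map_smul, smul_smul, mul_inv_cancel₀ htw, one_smul]
  exact ⟨_, hβ, hβH, hc'β⟩

/-- **Glue of the σ-infrastructure split of `BoundaryAbsoluteness`** (shape `C₁ → C₂ → C` for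
`route edit --split … --glue-by`). If conjugates exist (`C₁`) and conjugation is natural and
single-valued (`C₂`), then boundary Principle B holds as typed: `boundaryReadout_kernelDescent_of_subs`
at `X = 𝒳`, `h_i = g_i ≫ ι_o`, `w = ι_t`, its kernel hypothesis on every conjugate family being the
unconditional `boundaryReadout_fibreKernelInclusion`. Both hypotheses are theorems in print; in the
tree they are the named facts (J), (G), (C) (`ConjugationChartExistence`) and
`chartConjugation_canonical` (`ConjugationChartUniqueness`) — the landed `boundaryAbsoluteness_of_facts`
is (definitionally) this theorem applied to `exists_isConjugateClass_of_facts' hJ hG hC` and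
`conjugateNaturality_of_canonical hN`, so the split loses nothing. [cite: Deligne1982HodgeCycles, §2 Thm. 2.12]
[cite: CharlesSchnell2014Notes, §11.2.2 and Thm. 11.3.8] [cite: DeligneHodgeIII1974, Prop. 8.2.7] -/
theorem boundaryAbsoluteness_of_subs
    (h₁ : ∀ ⦃n : ℕ⦄ ⦃X : SchemeOver ℂ⦄, IsSmoothProjective n X →
      ∀ (σ : ℂ ≃+* ℂ) (k : ℕ) (c : complexBetti X k), ∃ c', IsConjugateClass σ X k c c')
    (h₂ : ∀ ⦃m n : ℕ⦄ ⦃Y X : SchemeOver ℂ⦄, IsSmoothProjective m Y → IsSmoothProjective n X →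
      ∀ (g : Y ⟶ X) (σ : ℂ ≃+* ℂ) (k : ℕ) (c : complexBetti X k)
        (c' : complexBetti (conjugateVariety σ X) k) (d' : complexBetti (conjugateVariety σ Y) k),
        IsConjugateClass σ X k c c' → IsConjugateClass σ Y k (complexBetti.map g k c) d' →
          d' = complexBetti.map (conjHom σ g) k c') :
    BoundaryAbsoluteness := by
  intro N p 𝒳 C f o h𝒳 hC₁ hf ι _ m Y g hY hcov ξ hξr hξh habs t n ht
  exact boundaryReadout_kernelDescent_of_subs h₁ h₂ h𝒳 (fun i => g i ≫ fiberι f o) hY (fiberι f t) ht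
    (fun σ k x hx => boundaryReadout_fibreKernelInclusion f o h𝒳 hC₁ hf g hY hcov σ k x hx t ht)
    p ξ hξr hξh habs

end Summit.HodgeConjecture.HodgeConjecture.Theorems

end
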